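import Mathlib
import Literature.RepresentationTheory.FiniteGroups.KLRGradedCellularBasis
import Literature.NumberTheory.DiophantineGeometry.FirstRowPeeling
import Literature.RepresentationTheory.FiniteGroups.VershikKerovMaxDegreeProofs
import Summits.MatrixMultiplication.MatrixMultiplication.Theorems.SnSubsetDichotomyNoThresholdSubsetTripleCardTableauPair

/-!
# `SnSubsetDichotomy.NoThresholdSubsetTriple`, line `klr-graded-polynomial-method`:
# stub `firstRowTail` (the first-row tail of the Plancherel measure)

For the index set `TableauPair n = Σ μ ⊢ n, Std(μ) × Std(μ)` of the Hu–Mathas basis (`n!` elements,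
`card_tableauPair`), the pairs whose shape has a first row of length `μ₁ ≥ 3√n` number at most
`n! · e^{-c√n}`:
`#{(μ, S, T) : μ₁ ≥ 3√n} = ∑_{μ ⊢ n, μ₁ ≥ 3√n} (f^μ)² ≤ n! · e^{-√n/10}` for `n ≥ 2025`.

Proof (crude, RSK-free). Group the shapes by the first part `a = μ₁`: a shape `μ ⊢ n` with
`μ₁ = a` is `(a, ν)` for a unique `ν ⊢ n - a` (Mathlib's `Nat.Partition.partitionWithPartEquiv`),
and `f^μ ≤ C(n, a) · f^ν` (tree: `numStandardTableaux_le_choose_mul`). Hence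
`∑_{μ₁ = a} (f^μ)² ≤ C(n,a)² · ∑_{ν ⊢ n-a} (f^ν)² = C(n,a)² (n-a)! = n! · C(n,a)/a!`
(Burnside identity `sum_sq_numStandardTableaux`), and
`C(n,a)/a! ≤ nᵃ/(a!)² ≤ (e² n/a²)ᵃ ≤ (9/10)ᵃ` once `a² ≥ 9n` (`aᵃ/a! ≤ eᵃ`, `e² ≤ 8.1`).
Summing the geometric series over `a ≥ ⌈3√n⌉`: `≤ 10 · n! · (9/10)^{3√n} ≤ 10 · n! · e^{-3√n/10}
≤ n! · e^{-√n/10}` for `√n ≥ 45`.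
-/

namespace Summit.MatrixMultiplication.MatrixMultiplication.Theorems

open Literature.RepresentationTheory.FiniteGroups (TableauPair)
open Literature.NumberTheory.DiophantineGeometry

/-- Counting same-shape pairs of standard tableaux with a shape condition `P`:
`#{(μ, S, T) : P μ} = ∑_{μ : P μ} (f^μ)²`. [folklore] -/
private theorem card_subtype_tableauPair (n : ℕ) (P : Nat.Partition n → Prop) [DecidablePred P] :
    Nat.card {i : TableauPair n // P i.1} =
      ∑ μ ∈ Finset.univ.filter P, numStandardTableaux μ ^ 2 := by
  classical
  rw [Nat.card_eq_fintype_card, Fintype.card_subtype, Finset.card_eq_sum_ones, Finset.sum_filter,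
    Finset.sum_filter]
  unfold TableauPair
  rw [Fintype.sum_sigma]
  refine Finset.sum_congr rfl fun μ _ => ?_
  split_ifs with h
  · rw [Finset.sum_const, smul_eq_mul, mul_one, Finset.card_univ, Fintype.card_prod, sq,
      numStandardTableaux_eq_card_stdFilling, Nat.card_eq_fintype_card]
  · rw [Finset.sum_const_zero]

/-- The first row of the diagram of `μ ⊢ n`, `n ≠ 0`, has length the largest part `μ.parts.sup`.
[folklore] -/
private theorem rowLen_zero_eq_sup {n : ℕ} (μ : Nat.Partition n) (hn : n ≠ 0) :
    μ.youngDiagram.rowLen 0 = μ.parts.sup := by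
  obtain ⟨ν, hs⟩ := exists_sortedParts_eq_sup_cons μ hn
  rw [youngDiagram_eq_ofRowLens_cons hs (sortedGE_cons_of_sortedParts_eq hs),
    rowLen_ofRowLens_cons_zero]

/-- The largest part of `μ ⊢ n`, `n ≠ 0`, is a part. [folklore] -/
private theorem sup_mem_parts {n : ℕ} (μ : Nat.Partition n) (hn : n ≠ 0) :
    μ.parts.sup ∈ μ.parts := by
  obtain ⟨ν, hs⟩ := exists_sortedParts_eq_sup_cons μ hn
  have h : μ.parts.sup ∈ μ.sortedParts := by
    rw [hs]
    exact List.mem_cons_self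
  exact (Multiset.mem_sort _).1 h

/-- **Shapes with a prescribed first row.** For `1 ≤ a ≤ n`:
`∑_{μ ⊢ n, μ₁ = a} (f^μ)² ≤ C(n, a)² · (n - a)!`, since `μ ↦ ν = μ ∖ a` is injective into the
partitions of `n - a` (`Nat.Partition.partitionWithPartEquiv`), `f^μ ≤ C(n,a) f^ν`
(`numStandardTableaux_le_choose_mul`) and `∑_ν (f^ν)² = (n-a)!` (`sum_sq_numStandardTableaux`).
[folklore] -/
private theorem sum_sq_fiber_le {n a : ℕ} (ha1 : 1 ≤ a) (han : a ≤ n) :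
    ∑ μ ∈ Finset.univ.filter (fun μ : Nat.Partition n => μ.youngDiagram.rowLen 0 = a),
        numStandardTableaux μ ^ 2 ≤
      n.choose a ^ 2 * (n - a).factorial := by
  classical
  have hn : n ≠ 0 := by omega
  set e := Nat.Partition.partitionWithPartEquiv ha1 han with he
  have hinj : Function.Injective (fun ν : Nat.Partition (n - a) => (e.symm ν).1) :=
    fun ν₁ ν₂ h => e.symm.injective (Subtype.ext h)
  have hQ : ∀ ν : Nat.Partition (n - a), (∀ b ∈ ν.parts, b ≤ a) →
      numStandardTableaux (e.symm ν).1 ≤ n.choose a * numStandardTableaux ν := by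
    intro ν hν
    have hp : (e.symm ν).1.parts = a ::ₘ ν.parts :=
      Nat.Partition.partitionWithPartEquiv_symm_apply_parts ha1 han ν
    have h := numStandardTableaux_le_choose_mul (sortedParts_eq_cons (e.symm ν).1 ν hp hν)
    rwa [Nat.choose_symm han] at h
  calc ∑ μ ∈ Finset.univ.filter (fun μ : Nat.Partition n => μ.youngDiagram.rowLen 0 = a),
        numStandardTableaux μ ^ 2
      ≤ ∑ μ ∈ (Finset.univ.filter fun ν : Nat.Partition (n - a) => ∀ b ∈ ν.parts, b ≤ a).image
          (fun ν => (e.symm ν).1), numStandardTableaux μ ^ 2 := by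
        apply Finset.sum_le_sum_of_subset
        intro μ hμ
        have hsup : μ.parts.sup = a := by
          rw [← rowLen_zero_eq_sup μ hn]
          exact (Finset.mem_filter.1 hμ).2
        have hm : a ∈ μ.parts := hsup ▸ sup_mem_parts μ hn
        rw [Finset.mem_image]
        refine ⟨e ⟨μ, hm⟩, ?_, ?_⟩
        · rw [Finset.mem_filter]
          refine ⟨Finset.mem_univ _, fun b hb => ?_⟩
          rw [he, Nat.Partition.partitionWithPartEquiv_apply_parts] at hb
          exact hsup ▸ Multiset.le_sup (Multiset.mem_of_mem_erase hb)
        · simp only [Equiv.symm_apply_apply]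
    _ = ∑ ν ∈ Finset.univ.filter (fun ν : Nat.Partition (n - a) => ∀ b ∈ ν.parts, b ≤ a),
          numStandardTableaux (e.symm ν).1 ^ 2 :=
        Finset.sum_image fun _ _ _ _ h => hinj h
    _ ≤ ∑ ν ∈ Finset.univ.filter (fun ν : Nat.Partition (n - a) => ∀ b ∈ ν.parts, b ≤ a),
          (n.choose a * numStandardTableaux ν) ^ 2 :=
        Finset.sum_le_sum fun ν hν => Nat.pow_le_pow_left (hQ ν (Finset.mem_filter.1 hν).2) 2
    _ ≤ ∑ ν : Nat.Partition (n - a), (n.choose a * numStandardTableaux ν) ^ 2 :=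
        Finset.sum_le_sum_of_subset (Finset.filter_subset _ _)
    _ = n.choose a ^ 2 * (n - a).factorial := by
        rw [← Literature.RepresentationTheory.FiniteGroups.sum_sq_numStandardTableaux (n - a),
          Finset.mul_sum]
        exact Finset.sum_congr rfl fun ν _ => by ring

/-- **Regrouping by the first row.** For `n ≠ 0`:
`∑_{μ ⊢ n, μ₁ ≥ 3√n} (f^μ)² ≤ ∑_{3√n ≤ a ≤ n} C(n,a)² (n-a)!`. [folklore] -/
private theorem sum_sq_le_sum_choose {n : ℕ} (hn : n ≠ 0) :
    ∑ μ ∈ Finset.univ.filter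
        (fun μ : Nat.Partition n => 3 * Real.sqrt n ≤ (μ.youngDiagram.rowLen 0 : ℝ)),
        numStandardTableaux μ ^ 2 ≤
      ∑ a ∈ (Finset.range (n + 1)).filter (fun a : ℕ => 3 * Real.sqrt n ≤ (a : ℝ)),
        n.choose a ^ 2 * (n - a).factorial := by
  classical
  set s := Finset.univ.filter
    (fun μ : Nat.Partition n => 3 * Real.sqrt n ≤ (μ.youngDiagram.rowLen 0 : ℝ)) with hs
  set t := (Finset.range (n + 1)).filter (fun a : ℕ => 3 * Real.sqrt n ≤ (a : ℝ)) with ht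
  have hmaps : ∀ μ ∈ s, μ.youngDiagram.rowLen 0 ∈ t := fun μ hμ => by
    rw [hs, Finset.mem_filter] at hμ
    rw [ht, Finset.mem_filter]
    exact ⟨Finset.mem_range.2 (Nat.lt_succ_of_le (rowLen_youngDiagram_zero_le μ)), hμ.2⟩
  rw [← Finset.sum_fiberwise_of_maps_to hmaps]
  refine Finset.sum_le_sum fun a ha => ?_
  rw [ht, Finset.mem_filter] at ha
  have han : a ≤ n := Nat.lt_succ_iff.1 (Finset.mem_range.1 ha.1)
  have ha1 : 1 ≤ a := by
    have h0 : (0 : ℝ) < 3 * Real.sqrt n :=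
      mul_pos (by norm_num) (Real.sqrt_pos.2 (by exact_mod_cast Nat.pos_of_ne_zero hn))
    have h1 : (0 : ℝ) < a := h0.trans_le ha.2
    exact_mod_cast h1
  calc ∑ μ ∈ s with μ.youngDiagram.rowLen 0 = a, numStandardTableaux μ ^ 2
      ≤ ∑ μ ∈ Finset.univ.filter (fun μ : Nat.Partition n => μ.youngDiagram.rowLen 0 = a),
          numStandardTableaux μ ^ 2 :=
        Finset.sum_le_sum_of_subset fun μ hμ => by
          rw [Finset.mem_filter] at hμ ⊢
          exact ⟨Finset.mem_univ _, hμ.2⟩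
    _ ≤ n.choose a ^ 2 * (n - a).factorial := sum_sq_fiber_le ha1 han

/-- **The term bound.** For `a ≤ n` with `a² ≥ 9n`: `C(n,a)² (n-a)! ≤ n! (9/10)ᵃ`, i.e.
`C(n,a) ≤ a! (9/10)ᵃ`, from `C(n,a) ≤ nᵃ/a!`, `aᵃ/a! ≤ eᵃ` and `e² n ≤ 8.1 n ≤ (9/10) a²`.
[folklore] -/
private theorem choose_sq_mul_factorial_le {n a : ℕ} (han : a ≤ n) (h9 : 9 * n ≤ a ^ 2) :
    ((n.choose a : ℕ) : ℝ) ^ 2 * ((n - a).factorial : ℕ) ≤ (n.factorial : ℝ) * (9 / 10) ^ a := by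
  have hE : Real.exp 1 ^ 2 ≤ 9 * (9 / 10) := by
    have h := Real.exp_one_lt_d9
    have h0 := Real.exp_pos 1
    nlinarith
  have hF : (0 : ℝ) < a.factorial := by positivity
  have h1 : (n.choose a : ℝ) * a.factorial * (n - a).factorial = n.factorial := by
    exact_mod_cast Nat.choose_mul_factorial_mul_factorial han
  have h2 : (n.choose a : ℝ) ≤ (n : ℝ) ^ a / a.factorial := by
    have h := Nat.choose_le_pow_div (α := ℝ) a n
    exact_mod_cast h
  have h3 : (a : ℝ) ^ a / a.factorial ≤ Real.exp 1 ^ a := by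
    rw [Real.exp_one_pow]
    exact Real.pow_div_factorial_le_exp _ (Nat.cast_nonneg a) a
  have h4 : (a : ℝ) ^ a ≤ Real.exp 1 ^ a * a.factorial := by
    rwa [div_le_iff₀ hF] at h3
  have h5 : (n : ℝ) * Real.exp 1 ^ 2 ≤ (9 / 10) * (a : ℝ) ^ 2 := by
    have h9' : (9 : ℝ) * n ≤ (a : ℝ) ^ 2 := by exact_mod_cast h9
    nlinarith [Real.exp_pos 1]
  have h6 : ((n : ℝ) * Real.exp 1 ^ 2) ^ a ≤ ((9 / 10) * (a : ℝ) ^ 2) ^ a :=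
    pow_le_pow_left₀ (by positivity) h5 a
  -- `nᵃ ≤ (9/10)ᵃ (a!)²`
  have h7 : (n : ℝ) ^ a ≤ (9 / 10) ^ a * (a.factorial : ℝ) ^ 2 := by
    have hEa : (0 : ℝ) < (Real.exp 1 ^ 2) ^ a := by positivity
    have h8 : ((a : ℝ) ^ a) ^ 2 ≤ (Real.exp 1 ^ a * a.factorial) ^ 2 :=
      pow_le_pow_left₀ (by positivity) h4 2
    have h9'' : (n : ℝ) ^ a * (Real.exp 1 ^ 2) ^ a ≤ (9 / 10) ^ a * ((a : ℝ) ^ a) ^ 2 := by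
      calc (n : ℝ) ^ a * (Real.exp 1 ^ 2) ^ a = ((n : ℝ) * Real.exp 1 ^ 2) ^ a := by ring
        _ ≤ ((9 / 10) * (a : ℝ) ^ 2) ^ a := h6
        _ = (9 / 10) ^ a * ((a : ℝ) ^ a) ^ 2 := by ring
    have h10 : (n : ℝ) ^ a * (Real.exp 1 ^ 2) ^ a ≤
        (9 / 10) ^ a * (a.factorial : ℝ) ^ 2 * (Real.exp 1 ^ 2) ^ a :=
      calc (n : ℝ) ^ a * (Real.exp 1 ^ 2) ^ a ≤ (9 / 10) ^ a * ((a : ℝ) ^ a) ^ 2 := h9''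
        _ ≤ (9 / 10) ^ a * (Real.exp 1 ^ a * a.factorial) ^ 2 :=
            mul_le_mul_of_nonneg_left h8 (by positivity)
        _ = (9 / 10) ^ a * (a.factorial : ℝ) ^ 2 * (Real.exp 1 ^ 2) ^ a := by ring
    exact le_of_mul_le_mul_right h10 hEa
  -- `C(n,a) ≤ (9/10)ᵃ a!`
  have hC : (n.choose a : ℝ) ≤ (9 / 10) ^ a * a.factorial := by
    calc (n.choose a : ℝ) ≤ (n : ℝ) ^ a / a.factorial := h2
      _ ≤ (9 / 10) ^ a * (a.factorial : ℝ) ^ 2 / a.factorial :=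
          div_le_div_of_nonneg_right h7 hF.le
      _ = (9 / 10) ^ a * a.factorial := by
          field_simp
  calc ((n.choose a : ℕ) : ℝ) ^ 2 * ((n - a).factorial : ℕ)
      = (n.choose a : ℝ) * ((n.choose a : ℝ) * (n - a).factorial) := by ring
    _ ≤ (9 / 10) ^ a * a.factorial * ((n.choose a : ℝ) * (n - a).factorial) :=
        mul_le_mul_of_nonneg_right hC (by positivity)
    _ = ((n.choose a : ℝ) * a.factorial * (n - a).factorial) * (9 / 10) ^ a := by ring
    _ = (n.factorial : ℝ) * (9 / 10) ^ a := by rw [h1]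

set_option linter.dupNamespace false in -- deliberate Summit.<S>.<P> duplicate
/-- **Stub `firstRowTail` (line `klr-graded-polynomial-method`, crux
`SnSubsetDichotomy.NoThresholdSubsetTriple`, stmt-MatrixMultiplication-8302): the first-row tail
of the Plancherel measure.** There are `c > 0` and `n₀` such that for `n ≥ n₀` the same-shape
pairs of standard Young tableaux with `n` cells whose shape has first row `μ₁ ≥ 3√n` number at
most `n! · e^{-c√n}`: `∑_{μ ⊢ n, μ₁ ≥ 3√n} (f^μ)² ≤ n! e^{-c√n}` (here `c = 1/10`, `n₀ = 2025`).
Grouping by `a = μ₁`: `∑_{μ₁ = a} (f^μ)² ≤ C(n,a)² (n-a)! = n! C(n,a)/a! ≤ n! (e²n/a²)ᵃ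
≤ n! (9/10)ᵃ` for `a ≥ 3√n`, and the geometric tail is `≤ 10 · n! · e^{-3√n/10}`. [folklore] -/
theorem firstRowTail : ∃ c : ℝ, 0 < c ∧ ∃ n₀ : ℕ, ∀ n ≥ n₀, (Nat.card {i : TableauPair n // 3 * Real.sqrt (n : ℝ) ≤ (i.1.youngDiagram.rowLen 0 : ℝ)} : ℝ) ≤ (n.factorial : ℝ) * Real.exp (-(c * Real.sqrt (n : ℝ))) := by
  refine ⟨1 / 10, by norm_num, 2025, fun n hn => ?_⟩
  classical
  have hn0 : n ≠ 0 := by omega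
  set t := (Finset.range (n + 1)).filter (fun a : ℕ => 3 * Real.sqrt n ≤ (a : ℝ)) with ht
  set k : ℕ := ⌈3 * Real.sqrt n⌉₊ with hk
  -- combinatorial part, in `ℕ`
  have h1 : Nat.card {i : TableauPair n // 3 * Real.sqrt (n : ℝ) ≤ (i.1.youngDiagram.rowLen 0 : ℝ)}
      ≤ ∑ a ∈ t, n.choose a ^ 2 * (n - a).factorial := by
    rw [card_subtype_tableauPair n
      (fun μ : Nat.Partition n => 3 * Real.sqrt n ≤ (μ.youngDiagram.rowLen 0 : ℝ))]
    exact sum_sq_le_sum_choose hn0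
  have h2 : (Nat.card {i : TableauPair n //
      3 * Real.sqrt (n : ℝ) ≤ (i.1.youngDiagram.rowLen 0 : ℝ)} : ℝ) ≤
      ∑ a ∈ t, ((n.choose a : ℕ) : ℝ) ^ 2 * ((n - a).factorial : ℕ) := by
    have h := h1
    exact_mod_cast h
  -- term bound
  have h3 : ∑ a ∈ t, ((n.choose a : ℕ) : ℝ) ^ 2 * ((n - a).factorial : ℕ) ≤
      ∑ a ∈ t, (n.factorial : ℝ) * (9 / 10) ^ a := by
    refine Finset.sum_le_sum fun a ha => ?_
    rw [ht, Finset.mem_filter] at ha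
    have han : a ≤ n := Nat.lt_succ_iff.1 (Finset.mem_range.1 ha.1)
    have h9 : 9 * n ≤ a ^ 2 := by
      have h0 : (0 : ℝ) ≤ 3 * Real.sqrt n := by positivity
      have hsq : (3 * Real.sqrt n) ^ 2 ≤ (a : ℝ) ^ 2 := pow_le_pow_left₀ h0 ha.2 2
      rw [mul_pow, Real.sq_sqrt (Nat.cast_nonneg n)] at hsq
      have h' : (9 : ℝ) * n ≤ (a : ℝ) ^ 2 := by linarith
      exact_mod_cast h'
    exact choose_sq_mul_factorial_le han h9
  -- geometric tail
  have h4 : ∑ a ∈ t, (9 / 10 : ℝ) ^ a ≤ ∑ a ∈ Finset.Ico k (n + 1), (9 / 10 : ℝ) ^ a := by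
    refine Finset.sum_le_sum_of_subset_of_nonneg (fun a ha => ?_) fun _ _ _ => by positivity
    rw [ht, Finset.mem_filter, Finset.mem_range] at ha
    rw [Finset.mem_Ico]
    exact ⟨Nat.ceil_le.2 ha.2, ha.1⟩
  have h5 : ∑ a ∈ Finset.Ico k (n + 1), (9 / 10 : ℝ) ^ a ≤ (9 / 10) ^ k / (1 - 9 / 10) :=
    geom_sum_Ico_le_of_lt_one (by norm_num) (by norm_num)
  have h6 : (9 / 10 : ℝ) ^ k ≤ Real.exp (-(3 / 10 * Real.sqrt n)) := by
    have hq : (9 / 10 : ℝ) ≤ Real.exp (-(1 / 10)) := by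
      have h := Real.add_one_le_exp (-(1 / 10))
      linarith
    calc (9 / 10 : ℝ) ^ k ≤ Real.exp (-(1 / 10)) ^ k := pow_le_pow_left₀ (by norm_num) hq k
      _ = Real.exp (k * (-(1 / 10))) := (Real.exp_nat_mul _ k).symm
      _ ≤ Real.exp (-(3 / 10 * Real.sqrt n)) := by
          rw [Real.exp_le_exp]
          have hk' : 3 * Real.sqrt n ≤ k := Nat.le_ceil _
          linarith
  have h7 : 10 * Real.exp (-(3 / 10 * Real.sqrt n)) ≤ Real.exp (-(1 / 10 * Real.sqrt n)) := by
    have hs : (45 : ℝ) ≤ Real.sqrt n := by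
      rw [Real.le_sqrt (by norm_num) (Nat.cast_nonneg n)]
      have h' : (2025 : ℝ) ≤ n := by exact_mod_cast hn
      linarith
    have h10 : (10 : ℝ) ≤ Real.exp (1 / 5 * Real.sqrt n) := by
      have h := Real.add_one_le_exp (1 / 5 * Real.sqrt n)
      linarith
    calc 10 * Real.exp (-(3 / 10 * Real.sqrt n))
        ≤ Real.exp (1 / 5 * Real.sqrt n) * Real.exp (-(3 / 10 * Real.sqrt n)) :=
          mul_le_mul_of_nonneg_right h10 (Real.exp_pos _).le
      _ = Real.exp (-(1 / 10 * Real.sqrt n)) := by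
          rw [← Real.exp_add]
          congr 1
          ring
  have hN : (0 : ℝ) ≤ n.factorial := Nat.cast_nonneg _
  calc (Nat.card {i : TableauPair n //
        3 * Real.sqrt (n : ℝ) ≤ (i.1.youngDiagram.rowLen 0 : ℝ)} : ℝ)
      ≤ ∑ a ∈ t, ((n.choose a : ℕ) : ℝ) ^ 2 * ((n - a).factorial : ℕ) := h2
    _ ≤ ∑ a ∈ t, (n.factorial : ℝ) * (9 / 10) ^ a := h3
    _ = (n.factorial : ℝ) * ∑ a ∈ t, (9 / 10 : ℝ) ^ a := by rw [Finset.mul_sum]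
    _ ≤ (n.factorial : ℝ) * ((9 / 10) ^ k / (1 - 9 / 10)) :=
        mul_le_mul_of_nonneg_left (h4.trans h5) hN
    _ = (n.factorial : ℝ) * (10 * (9 / 10) ^ k) := by
        congr 1
        norm_num
        ring
    _ ≤ (n.factorial : ℝ) * (10 * Real.exp (-(3 / 10 * Real.sqrt n))) :=
        mul_le_mul_of_nonneg_left (mul_le_mul_of_nonneg_left h6 (by norm_num)) hN
    _ ≤ (n.factorial : ℝ) * Real.exp (-(1 / 10 * Real.sqrt n)) :=
        mul_le_mul_of_nonneg_left h7 hN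

end Summit.MatrixMultiplication.MatrixMultiplication.Theorems
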